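import Literature.NumberTheory.Automorphic.GL2CUnitaryKTypes
import Literature.NumberTheory.Automorphic.GL2ComplexCasimirScalar
import HarnessLib

/-!
# The six operators of a real `𝔤𝔩₂(ℂ)`-module: the bridge from a real Lie algebra representation
# `ρ : 𝔤𝔩₂(ℂ) →ₗ⁅ℝ⁆ End_ℂ C` (and its Harish-Chandra parameter) to `GL2CKType.Ops`

Glue between the abstract `K`-type analysis of `GL2CUnitaryKTypes` (six operators
`L(E), L(F), L(H), R(E), R(F), R(H)` with the `𝔰𝔩₂ × 𝔰𝔩₂` relations, Casimir scalars, a positive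
form) and the tree's archimedean vocabulary at a complex place (`GL2ComplexCasimirScalar`: the
factorisation `ofRho ρ` of a REAL Lie algebra representation `ρ` of `𝔤𝔩₂(ℂ)` into the commuting
complex-linear `L = Φ_id`, `R = Φ_conj`, `ρ X = L X + R X̄`, and the scalars of
`scalars_of_hasHCParameter` on a module of Harish-Chandra parameter `χ(id) = {s₁, s₂}`,
`χ(conj) = {t₁, t₂}`) [cite: Knapp2002, §VI.1 and Thm. 5.44]:

* `mE, mF, mH` — the `𝔰𝔩₂`-triple of `2 × 2` matrices and its brackets;
* `opsOf Ψ` — the six operators of a factorwise representation `Ψ` (`HCWt.FactorRep ℂ 2 C`), lawful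
  (`isLawful_opsOf`); `casL (opsOf Ψ) = cas Ψ id − ½ Ψ_id(1)²` (`casL_opsOf`), hence on a module of
  parameter `χ`: **`casL = ½((s₁ − s₂)² − 1)`, `casR = ½((t₁ − t₂)² − 1)`** (`casL_casR_of_hasHCParameter`);
* for `Ψ = ofRho ρ`: the `𝔨`- and `𝔭`-operators through `ρ` of explicit (skew-)Hermitian matrices
  (`Ek_eq`, `Fk_eq`, `Hk_eq`, `Pp_eq`, `Pm_eq`, `P0_eq_rho`), the transfer of SKEW-SYMMETRY of `ρ(X)`
  (`tr X = 0`) for a positive form to the adjointness hypotheses `L(Z)† = −R(Z̄)` of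
  `GL2CUnitaryKTypes` (`adjoint_of_skew`), of `𝔲(2)`-stable finite-dimensional subspaces to the
  `𝔨`-finiteness hypothesis (`kFinite_of_skewHermitian_stable`), and "killed by the six operators ⇒
  killed by `ρ(𝔰𝔩₂(ℂ))`" (`rho_apply_eq_zero_of_killed`).

Everything is proved; the definitions are the three matrices and `opsOf`.
-/

noncomputable section

-- Mathlib idiom (Mathlib/Algebra/Lie/OfAssociative.lean), as in `GL2ComplexCasimirScalar`: commutator brackets on the matrix
-- algebra `𝔤𝔩₂(ℂ)` and on `Module.End`.
attribute [local instance 100] LieRing.ofAssociativeRing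

open scoped Matrix ComplexConjugate
open Complex

namespace Literature.NumberTheory.Automorphic

namespace GL2CKType

open GLnComplexCasimir GL2ComplexCasimir HCWt

variable {C : Type*} [AddCommGroup C] [Module ℂ C]

/-! ### The `𝔰𝔩₂`-triple of matrices -/

/-- `E = E₀₁`. [folklore] -/
def mE : Matrix (Fin 2) (Fin 2) ℂ := Matrix.single 0 1 1
/-- `F = E₁₀`. [folklore] -/
def mF : Matrix (Fin 2) (Fin 2) ℂ := Matrix.single 1 0 1
/-- `H = E₀₀ − E₁₁`. [folklore] -/
def mH : Matrix (Fin 2) (Fin 2) ℂ := Matrix.single 0 0 1 - Matrix.single 1 1 1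

/-- `E` as an explicit matrix. [folklore] -/
theorem mE_eq : mE = !![0, 1; 0, 0] := by
  ext i j; fin_cases i <;> fin_cases j <;> simp [mE]
/-- `F` as an explicit matrix. [folklore] -/
theorem mF_eq : mF = !![0, 0; 1, 0] := by
  ext i j; fin_cases i <;> fin_cases j <;> simp [mF]
/-- `H` as an explicit matrix. [folklore] -/
theorem mH_eq : mH = !![1, 0; 0, -1] := by
  ext i j; fin_cases i <;> fin_cases j <;> simp [mH]
/-- `1 = E₀₀ + E₁₁`. [folklore] -/
theorem one_eq_single_add :
    (1 : Matrix (Fin 2) (Fin 2) ℂ) = Matrix.single 0 0 1 + Matrix.single 1 1 1 := by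
  ext i j; fin_cases i <;> fin_cases j <;> simp

/-- `[H, E] = 2E`. [folklore] -/
theorem lie_mH_mE : ⁅mH, mE⁆ = (2 : ℂ) • mE := by
  rw [Ring.lie_def, mH_eq, mE_eq]
  ext i j; fin_cases i <;> fin_cases j <;> norm_num
/-- `[H, F] = −2F`. [folklore] -/
theorem lie_mH_mF : ⁅mH, mF⁆ = -((2 : ℂ) • mF) := by
  rw [Ring.lie_def, mH_eq, mF_eq]
  ext i j; fin_cases i <;> fin_cases j <;> norm_num
/-- `[E, F] = H`. [folklore] -/
theorem lie_mE_mF : ⁅mE, mF⁆ = mH := by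
  rw [Ring.lie_def, mH_eq, mE_eq, mF_eq]
  ext i j; fin_cases i <;> fin_cases j <;> simp

/-- `E₀₀ = ½(1 + H)`. [folklore] -/
theorem single_zero_zero_eq :
    (Matrix.single 0 0 1 : Matrix (Fin 2) (Fin 2) ℂ) = (2 : ℂ)⁻¹ • (1 + mH) := by
  rw [one_eq_single_add, mH]
  ext i j; fin_cases i <;> fin_cases j <;> norm_num
/-- `E₁₁ = ½(1 − H)`. [folklore] -/
theorem single_one_one_eq :
    (Matrix.single 1 1 1 : Matrix (Fin 2) (Fin 2) ℂ) = (2 : ℂ)⁻¹ • (1 - mH) := by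
  rw [one_eq_single_add, mH]
  ext i j; fin_cases i <;> fin_cases j <;> norm_num

/-- Traces: `tr E = tr F = tr H = 0`. [folklore] -/
theorem trace_mE : mE.trace = 0 := by simp [mE_eq, Matrix.trace_fin_two]
/-- [folklore] -/
theorem trace_mF : mF.trace = 0 := by simp [mF_eq, Matrix.trace_fin_two]
/-- [folklore] -/
theorem trace_mH : mH.trace = 0 := by simp [mH_eq, Matrix.trace_fin_two]

/-! ### The six operators of a factorwise representation -/

/-- The six operators `L(E), L(F), L(H), R(E), R(F), R(H)` of a factorwise representation
`Ψ = (Ψ_id, Ψ_conj)` of `𝔤𝔩₂(ℂ)_ℂ = 𝔤𝔩₂(ℂ)_{id} × 𝔤𝔩₂(ℂ)_{conj}`: `L = Ψ_id`, `R = Ψ_conj`.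
[cite: Knapp2002, §VI.1] -/
def opsOf (Ψ : FactorRep ℂ 2 C) : Ops C where
  LE := Ψ.toFun (AlgHom.id ℝ ℂ) mE
  LF := Ψ.toFun (AlgHom.id ℝ ℂ) mF
  LH := Ψ.toFun (AlgHom.id ℝ ℂ) mH
  RE := Ψ.toFun (Complex.conjAe : ℂ →ₐ[ℝ] ℂ) mE
  RF := Ψ.toFun (Complex.conjAe : ℂ →ₐ[ℝ] ℂ) mF
  RH := Ψ.toFun (Complex.conjAe : ℂ →ₐ[ℝ] ℂ) mH

section Lawful

variable (Ψ : FactorRep ℂ 2 C)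

/-- Unfolding. [folklore] -/
@[simp] theorem opsOf_LE : (opsOf Ψ).LE = Ψ.toFun (AlgHom.id ℝ ℂ) mE := rfl
/-- Unfolding. [folklore] -/
@[simp] theorem opsOf_LF : (opsOf Ψ).LF = Ψ.toFun (AlgHom.id ℝ ℂ) mF := rfl
/-- Unfolding. [folklore] -/
@[simp] theorem opsOf_LH : (opsOf Ψ).LH = Ψ.toFun (AlgHom.id ℝ ℂ) mH := rfl
/-- Unfolding. [folklore] -/
@[simp] theorem opsOf_RE : (opsOf Ψ).RE = Ψ.toFun (Complex.conjAe : ℂ →ₐ[ℝ] ℂ) mE := rfl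
/-- Unfolding. [folklore] -/
@[simp] theorem opsOf_RF : (opsOf Ψ).RF = Ψ.toFun (Complex.conjAe : ℂ →ₐ[ℝ] ℂ) mF := rfl
/-- Unfolding. [folklore] -/
@[simp] theorem opsOf_RH : (opsOf Ψ).RH = Ψ.toFun (Complex.conjAe : ℂ →ₐ[ℝ] ℂ) mH := rfl

/-- `Ψ_τ [X, Y] v = Ψ_τ X (Ψ_τ Y v) − Ψ_τ Y (Ψ_τ X v)`. [folklore] -/
theorem factor_lie_apply (τ : ℂ →ₐ[ℝ] ℂ) (X Y : Matrix (Fin 2) (Fin 2) ℂ) (v : C) :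
    Ψ.toFun τ ⁅X, Y⁆ v = Ψ.toFun τ X (Ψ.toFun τ Y v) - Ψ.toFun τ Y (Ψ.toFun τ X v) := by
  rw [LieHom.map_lie, Ring.lie_def]; rfl

/-- The two factors commute: `Ψ_conj Y (Ψ_id X v) = Ψ_id X (Ψ_conj Y v)`. [folklore] -/
theorem factor_comm_apply (X Y : Matrix (Fin 2) (Fin 2) ℂ) (v : C) :
    Ψ.toFun (Complex.conjAe : ℂ →ₐ[ℝ] ℂ) Y (Ψ.toFun (AlgHom.id ℝ ℂ) X v) =
      Ψ.toFun (AlgHom.id ℝ ℂ) X (Ψ.toFun (Complex.conjAe : ℂ →ₐ[ℝ] ℂ) Y v) := by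
  have h := Ψ.commute _ _ id_ne_conjAe X Y
  exact (LinearMap.congr_fun h v).symm

/-- **The six operators of a factorwise representation are lawful** (the `𝔰𝔩₂ × 𝔰𝔩₂` relations).
[cite: Knapp2002, §VI.1] -/
theorem isLawful_opsOf : (opsOf Ψ).IsLawful where
  lhe v := by
    have h := factor_lie_apply Ψ (AlgHom.id ℝ ℂ) mH mE v
    rw [lie_mH_mE, map_smul, LinearMap.smul_apply] at h
    simp only [opsOf_LH, opsOf_LE]
    rw [← sub_eq_iff_eq_add'] ; exact h.symm
  lhf v := by
    have h := factor_lie_apply Ψ (AlgHom.id ℝ ℂ) mH mF v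
    rw [lie_mH_mF, map_neg, map_smul, LinearMap.neg_apply, LinearMap.smul_apply] at h
    simp only [opsOf_LH, opsOf_LF]
    rw [sub_eq_add_neg, ← sub_eq_iff_eq_add']; exact h.symm
  lef v := by
    have h := factor_lie_apply Ψ (AlgHom.id ℝ ℂ) mE mF v
    rw [lie_mE_mF] at h
    simp only [opsOf_LE, opsOf_LF, opsOf_LH]
    rw [← sub_eq_iff_eq_add']; exact h.symm
  rhe v := by
    have h := factor_lie_apply Ψ (Complex.conjAe : ℂ →ₐ[ℝ] ℂ) mH mE v
    rw [lie_mH_mE, map_smul, LinearMap.smul_apply] at h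
    simp only [opsOf_RH, opsOf_RE]
    rw [← sub_eq_iff_eq_add']; exact h.symm
  rhf v := by
    have h := factor_lie_apply Ψ (Complex.conjAe : ℂ →ₐ[ℝ] ℂ) mH mF v
    rw [lie_mH_mF, map_neg, map_smul, LinearMap.neg_apply, LinearMap.smul_apply] at h
    simp only [opsOf_RH, opsOf_RF]
    rw [sub_eq_add_neg, ← sub_eq_iff_eq_add']; exact h.symm
  ref v := by
    have h := factor_lie_apply Ψ (Complex.conjAe : ℂ →ₐ[ℝ] ℂ) mE mF v
    rw [lie_mE_mF] at h
    simp only [opsOf_RE, opsOf_RF, opsOf_RH]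
    rw [← sub_eq_iff_eq_add']; exact h.symm
  cEE v := factor_comm_apply Ψ mE mE v
  cEF v := factor_comm_apply Ψ mF mE v
  cEH v := factor_comm_apply Ψ mH mE v
  cFE v := factor_comm_apply Ψ mE mF v
  cFF v := factor_comm_apply Ψ mF mF v
  cFH v := factor_comm_apply Ψ mH mF v
  cHE v := factor_comm_apply Ψ mE mH v
  cHF v := factor_comm_apply Ψ mF mH v
  cHH v := factor_comm_apply Ψ mH mH v

/-! ### The Casimir operators -/

/-- **`casL = C_id − ½ Ψ_id(1)²`**: `∑_{a,b} Ψ(E_{ab})Ψ(E_{ba}) = ½ Ψ(1)² + ½ Ψ(H)² + Ψ(E)Ψ(F) + Ψ(F)Ψ(E)`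
(`E₀₀ = ½(1 + H)`, `E₁₁ = ½(1 − H)`). [cite: Knapp2002, (5.24)] -/
theorem cas_eq (τ : ℂ →ₐ[ℝ] ℂ) :
    cas Ψ τ = (2 : ℂ)⁻¹ • (Ψ.toFun τ 1 * Ψ.toFun τ 1) +
      ((2 : ℂ)⁻¹ • (Ψ.toFun τ mH * Ψ.toFun τ mH) + Ψ.toFun τ mE * Ψ.toFun τ mF +
        Ψ.toFun τ mF * Ψ.toFun τ mE) := by
  simp only [cas, Fin.sum_univ_two]
  rw [single_zero_zero_eq, single_one_one_eq]
  simp only [map_smul, map_add, map_sub]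
  rw [show (Matrix.single 0 1 1 : Matrix (Fin 2) (Fin 2) ℂ) = mE from rfl,
    show (Matrix.single 1 0 1 : Matrix (Fin 2) (Fin 2) ℂ) = mF from rfl]
  set Z := Ψ.toFun τ 1
  set H' := Ψ.toFun τ mH
  set E' := Ψ.toFun τ mE
  set F' := Ψ.toFun τ mF
  simp only [smul_add, smul_sub, smul_mul_assoc, mul_smul_comm, smul_smul, add_mul, mul_add,
    sub_mul, mul_sub]
  norm_num
  abel_nf
  module

/-- `casL (opsOf Ψ) = C_id − ½ Ψ_id(1)²`. [cite: Knapp2002, (5.24)] -/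
theorem casL_opsOf : (opsOf Ψ).casL = cas Ψ (AlgHom.id ℝ ℂ) -
    (2 : ℂ)⁻¹ • (Ψ.toFun (AlgHom.id ℝ ℂ) 1 * Ψ.toFun (AlgHom.id ℝ ℂ) 1) := by
  rw [cas_eq, Ops.casL]; simp only [opsOf_LH, opsOf_LE, opsOf_LF]; abel

/-- `casR (opsOf Ψ) = C_conj − ½ Ψ_conj(1)²`. [cite: Knapp2002, (5.24)] -/
theorem casR_opsOf : (opsOf Ψ).casR = cas Ψ (Complex.conjAe : ℂ →ₐ[ℝ] ℂ) -
    (2 : ℂ)⁻¹ • (Ψ.toFun (Complex.conjAe : ℂ →ₐ[ℝ] ℂ) 1 * Ψ.toFun (Complex.conjAe : ℂ →ₐ[ℝ] ℂ) 1) := by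
  rw [cas_eq, Ops.casR]; simp only [opsOf_RH, opsOf_RE, opsOf_RF]; abel

end Lawful

/-! ### From a real representation `ρ` of `𝔤𝔩₂(ℂ)`: Casimir scalars from the Harish-Chandra parameter -/

section Rho

variable (ρ : Matrix (Fin 2) (Fin 2) ℂ →ₗ⁅ℝ⁆ Module.End ℂ C)

/-- **The Casimir scalars from the Harish-Chandra parameter**: on a real `𝔤𝔩₂(ℂ)`-module of
parameter `χ(id) = {s₁, s₂}`, `χ(conj) = {t₁, t₂}` the operators `casL`, `casR` of the six operators
of `ofRho ρ` act by `½((s₁ − s₂)² − 1)` and `½((t₁ − t₂)² − 1)`. [cite: Knapp2002, Thm. 5.44] -/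
theorem casL_casR_of_hasHCParameter {χ : (ℂ →ₐ[ℝ] ℂ) → Multiset ℂ} (hχ : HasHCParameter ρ χ)
    {s₁ s₂ t₁ t₂ : ℂ} (hs : χ (AlgHom.id ℝ ℂ) = {s₁, s₂})
    (ht : χ (Complex.conjAe : ℂ →ₐ[ℝ] ℂ) = {t₁, t₂}) :
    (∀ v, (opsOf (ofRho ρ)).casL v = ((2 : ℂ)⁻¹ * ((s₁ - s₂) ^ 2 - 1)) • v) ∧
      ∀ v, (opsOf (ofRho ρ)).casR v = ((2 : ℂ)⁻¹ * ((t₁ - t₂) ^ 2 - 1)) • v := by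
  obtain ⟨⟨h1, h1'⟩, hc, hc'⟩ := scalars_of_hasHCParameter ρ hχ hs ht
  refine ⟨fun v => ?_, fun v => ?_⟩
  · rw [casL_opsOf, hc, h1, LinearMap.sub_apply, LinearMap.smul_apply, LinearMap.smul_apply,
      Module.End.mul_apply, LinearMap.smul_apply, LinearMap.smul_apply, Module.End.one_apply,
      Module.End.one_apply, smul_smul, smul_smul, ← sub_smul]
    congr 1; ring
  · rw [casR_opsOf, hc', h1', LinearMap.sub_apply, LinearMap.smul_apply, LinearMap.smul_apply,
      Module.End.mul_apply, LinearMap.smul_apply, LinearMap.smul_apply, Module.End.one_apply,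
      Module.End.one_apply, smul_smul, smul_smul, ← sub_smul]
    congr 1; ring

/-! ### The `𝔨`- and `𝔭`-operators through `ρ` -/

/-- `id.mapMatrix X = X`. [folklore] -/
theorem mapMatrix_id (X : Matrix (Fin 2) (Fin 2) ℂ) : (AlgHom.id ℝ ℂ).mapMatrix X = X := by
  ext i j; rfl

/-- `conj.mapMatrix` fixes the real matrices `E, F, H`. [folklore] -/
theorem mapMatrix_conj_mE : (Complex.conjAe : ℂ →ₐ[ℝ] ℂ).mapMatrix mE = mE := by
  rw [mE_eq]; ext i j; fin_cases i <;> fin_cases j <;> simp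
/-- [folklore] -/
theorem mapMatrix_conj_mF : (Complex.conjAe : ℂ →ₐ[ℝ] ℂ).mapMatrix mF = mF := by
  rw [mF_eq]; ext i j; fin_cases i <;> fin_cases j <;> simp
/-- [folklore] -/
theorem mapMatrix_conj_mH : (Complex.conjAe : ℂ →ₐ[ℝ] ℂ).mapMatrix mH = mH := by
  rw [mH_eq]; ext i j; fin_cases i <;> fin_cases j <;> simp

/-- `L(X) v = ½ (ρ X v − i ρ(iX) v)` for the real matrices `X = E, F, H` (and any `X`). [cite: Knapp2002, §VI.1] -/
theorem L_apply (X : Matrix (Fin 2) (Fin 2) ℂ) (v : C) :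
    (ofRho ρ).toFun (AlgHom.id ℝ ℂ) X v = (2 : ℂ)⁻¹ • (ρ X v - I • ρ (I • X) v) := by
  rw [ofRho_apply, mapMatrix_id, tauProj, LinearMap.smul_apply, LinearMap.add_apply,
    LinearMap.smul_apply]
  simp [Complex.conj_I, sub_eq_add_neg]

/-- `R(X) v = ½ (ρ X v + i ρ(iX) v)` for a REAL matrix `X` (`X̄ = X`). [cite: Knapp2002, §VI.1] -/
theorem R_apply {X : Matrix (Fin 2) (Fin 2) ℂ} (hX : (Complex.conjAe : ℂ →ₐ[ℝ] ℂ).mapMatrix X = X)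
    (v : C) :
    (ofRho ρ).toFun (Complex.conjAe : ℂ →ₐ[ℝ] ℂ) X v = (2 : ℂ)⁻¹ • (ρ X v + I • ρ (I • X) v) := by
  rw [ofRho_apply, hX, tauProj, LinearMap.smul_apply, LinearMap.add_apply, LinearMap.smul_apply]
  simp [conjAe_I]

/-- **`E_k` through `ρ`**: `E_k v = ½ ρ(E − F) v − (i/2) ρ(i(E + F)) v` — `E − F`, `i(E + F) ∈ 𝔲(2)`.
[cite: Knapp2002, §VI.1] -/
theorem Ek_eq (v : C) : (opsOf (ofRho ρ)).Ek v =
    (2 : ℂ)⁻¹ • ρ (mE - mF) v - ((2 : ℂ)⁻¹ * I) • ρ (I • (mE + mF)) v := by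
  rw [Ops.Ek_apply, opsOf_LE, opsOf_RF, L_apply, R_apply ρ mapMatrix_conj_mF]
  simp only [map_sub, map_add, smul_add, LinearMap.sub_apply, LinearMap.add_apply, smul_sub,
    mul_smul]
  module

/-- **`F_k` through `ρ`**: `F_k v = ½ ρ(F − E) v − (i/2) ρ(i(E + F)) v`. [cite: Knapp2002, §VI.1] -/
theorem Fk_eq (v : C) : (opsOf (ofRho ρ)).Fk v =
    (2 : ℂ)⁻¹ • ρ (mF - mE) v - ((2 : ℂ)⁻¹ * I) • ρ (I • (mE + mF)) v := by
  rw [Ops.Fk_apply, opsOf_LF, opsOf_RE, L_apply, R_apply ρ mapMatrix_conj_mE]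
  simp only [map_sub, map_add, smul_add, LinearMap.sub_apply, LinearMap.add_apply, smul_sub,
    mul_smul]
  module

/-- **`H_k` through `ρ`**: `H_k v = −i ρ(iH) v` — `iH ∈ 𝔲(2)`. [cite: Knapp2002, §VI.1] -/
theorem Hk_eq (v : C) : (opsOf (ofRho ρ)).Hk v = -(I • ρ (I • mH) v) := by
  rw [Ops.Hk_apply, opsOf_LH, opsOf_RH, L_apply, R_apply ρ mapMatrix_conj_mH]
  module

/-- **`P₀` through `ρ`**: `P₀ = ρ(H)` — `H ∈ 𝔭₀`. [cite: Knapp2002, §VI.1] -/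
theorem P0_eq_rho (v : C) : (opsOf (ofRho ρ)).P0 v = ρ mH v := by
  rw [Ops.P0_apply, opsOf_LH, opsOf_RH, L_apply, R_apply ρ mapMatrix_conj_mH]
  module

/-- **`P₊` through `ρ`**: `P₊ v = ½ ρ(E + F) v − (i/2) ρ(i(E − F)) v` — `E + F`, `i(E − F) ∈ 𝔭₀`.
[cite: Knapp2002, §VI.1] -/
theorem Pp_eq (v : C) : (opsOf (ofRho ρ)).Pp v =
    (2 : ℂ)⁻¹ • ρ (mE + mF) v - ((2 : ℂ)⁻¹ * I) • ρ (I • (mE - mF)) v := by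
  rw [Ops.Pp_apply, opsOf_LE, opsOf_RF, L_apply, R_apply ρ mapMatrix_conj_mF]
  simp only [map_sub, map_add, smul_add, LinearMap.sub_apply, LinearMap.add_apply, smul_sub,
    mul_smul]
  module

/-- **`P₋` through `ρ`**: `P₋ v = ½ ρ(E + F) v + (i/2) ρ(i(E − F)) v`. [cite: Knapp2002, §VI.1] -/
theorem Pm_eq (v : C) : (opsOf (ofRho ρ)).Pm v =
    (2 : ℂ)⁻¹ • ρ (mE + mF) v + ((2 : ℂ)⁻¹ * I) • ρ (I • (mE - mF)) v := by
  rw [Ops.Pm_apply, opsOf_LF, opsOf_RE, L_apply, R_apply ρ mapMatrix_conj_mE]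
  simp only [map_sub, map_add, smul_add, LinearMap.sub_apply, LinearMap.add_apply, smul_sub,
    mul_smul]
  module

/-! ### Transfers: skew-symmetry, `𝔨`-finiteness, vanishing -/

/-- **Skew-symmetry of `ρ(𝔰𝔩₂(ℂ))` gives `L(Z)† = −R(Z̄)`**: if `⟨ρ X x, y⟩ = −⟨x, ρ X y⟩` for every
traceless `X` (the Petersson form: right translations are unitary), then
`⟨L(E) x, y⟩ = −⟨x, R(E) y⟩`, `⟨L(F) x, y⟩ = −⟨x, R(F) y⟩`, `⟨L(H) x, y⟩ = −⟨x, R(H) y⟩` — the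
hypotheses `hE hF hH` of `GL2CUnitaryKTypes`. [cite: Harder1987, §3.1] -/
theorem adjoint_of_skew {ip : C → C → ℂ} (hip : Kuga.IsPosForm ip)
    (hskew : ∀ X : Matrix (Fin 2) (Fin 2) ℂ, X.trace = 0 → ∀ x y, ip (ρ X x) y = -ip x (ρ X y)) :
    (∀ x y, ip ((opsOf (ofRho ρ)).LE x) y = -ip x ((opsOf (ofRho ρ)).RE y)) ∧
    (∀ x y, ip ((opsOf (ofRho ρ)).LF x) y = -ip x ((opsOf (ofRho ρ)).RF y)) ∧
    (∀ x y, ip ((opsOf (ofRho ρ)).LH x) y = -ip x ((opsOf (ofRho ρ)).RH y)) := by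
  have key : ∀ {X : Matrix (Fin 2) (Fin 2) ℂ}, (Complex.conjAe : ℂ →ₐ[ℝ] ℂ).mapMatrix X = X →
      X.trace = 0 → ∀ x y, ip ((ofRho ρ).toFun (AlgHom.id ℝ ℂ) X x) y =
        -ip x ((ofRho ρ).toFun (Complex.conjAe : ℂ →ₐ[ℝ] ℂ) X y) := by
    intro X hX htr x y
    have htr' : (I • X).trace = 0 := by rw [Matrix.trace_smul, htr, smul_zero]
    rw [L_apply, R_apply ρ hX, hip.smul_left, hip.sub_left, hip.smul_left, hskew X htr,
      hskew _ htr', hip.smul_right, hip.add_right, hip.smul_right]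
    simp only [map_inv₀, map_ofNat, Complex.conj_I]
    ring
  simp only [opsOf_LE, opsOf_RE, opsOf_LF, opsOf_RF, opsOf_LH, opsOf_RH]
  exact ⟨key mapMatrix_conj_mE trace_mE, key mapMatrix_conj_mF trace_mF, key mapMatrix_conj_mH trace_mH⟩

/-- `E − F`, `i(E + F)`, `iH` are skew-Hermitian. [folklore] -/
theorem conjTranspose_mE_sub_mF : (mE - mF)ᴴ = -(mE - mF) := by
  rw [mE_eq, mF_eq]; ext i j; fin_cases i <;> fin_cases j <;> simp [Matrix.conjTranspose_apply]
/-- [folklore] -/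
theorem conjTranspose_I_smul_mE_add_mF : (I • (mE + mF))ᴴ = -(I • (mE + mF)) := by
  rw [mE_eq, mF_eq]; ext i j; fin_cases i <;> fin_cases j <;> simp [Matrix.conjTranspose_apply]
/-- [folklore] -/
theorem conjTranspose_I_smul_mH : (I • mH)ᴴ = -(I • mH) := by
  rw [mH_eq]; ext i j; fin_cases i <;> fin_cases j <;> simp [Matrix.conjTranspose_apply]

/-- **`𝔨`-finiteness from `𝔲(2)`-stable finite-dimensional subspaces**: if every vector lies in a
finite-dimensional subspace stable under `ρ(Y)` for all skew-Hermitian `Y` (the span of its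
`U(2)`-translates), it lies in one stable under `E_k, F_k, H_k` — the hypothesis `hfin` of
`GL2CUnitaryKTypes`. [cite: Harder1987, §3.1] -/
theorem kFinite_of_skewHermitian_stable
    (h : ∀ v : C, ∃ S : Submodule ℂ C, v ∈ S ∧ FiniteDimensional ℂ S ∧
      ∀ Y : Matrix (Fin 2) (Fin 2) ℂ, Yᴴ = -Y → ∀ x ∈ S, ρ Y x ∈ S) (v : C) :
    ∃ S : Submodule ℂ C, v ∈ S ∧ FiniteDimensional ℂ S ∧
      (∀ x ∈ S, (opsOf (ofRho ρ)).Ek x ∈ S) ∧ (∀ x ∈ S, (opsOf (ofRho ρ)).Fk x ∈ S) ∧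
        (∀ x ∈ S, (opsOf (ofRho ρ)).Hk x ∈ S) := by
  obtain ⟨S, hv, hfd, hS⟩ := h v
  refine ⟨S, hv, hfd, fun x hx => ?_, fun x hx => ?_, fun x hx => ?_⟩
  · rw [Ek_eq]
    exact S.sub_mem (S.smul_mem _ (hS _ conjTranspose_mE_sub_mF x hx))
      (S.smul_mem _ (hS _ conjTranspose_I_smul_mE_add_mF x hx))
  · rw [Fk_eq]
    refine S.sub_mem (S.smul_mem _ ?_) (S.smul_mem _ (hS _ conjTranspose_I_smul_mE_add_mF x hx))
    have : mF - mE = -(mE - mF) := by abel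
    rw [this, map_neg, LinearMap.neg_apply]
    exact S.neg_mem (hS _ conjTranspose_mE_sub_mF x hx)
  · rw [Hk_eq]
    exact S.neg_mem (S.smul_mem _ (hS _ conjTranspose_I_smul_mH x hx))

/-- A traceless `2 × 2` complex matrix is `αE + βF + γH`. [folklore] -/
theorem eq_of_trace_eq_zero {X : Matrix (Fin 2) (Fin 2) ℂ} (hX : X.trace = 0) :
    X = X 0 1 • mE + X 1 0 • mF + X 0 0 • mH := by
  rw [Matrix.trace_fin_two] at hX
  have h11 : X 1 1 = -X 0 0 := by linear_combination hX
  rw [mE_eq, mF_eq, mH_eq]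
  ext i j; fin_cases i <;> fin_cases j <;> simp [h11]

/-- **Killed by the six operators ⇒ killed by `ρ(𝔰𝔩₂(ℂ))`**: a vector annihilated by
`L(E), L(F), L(H), R(E), R(F), R(H)` is annihilated by `ρ X` for every traceless `X`
(`ρ X = L X + R X̄`, `L`, `R` complex-linear). [cite: Knapp2002, §VI.1] -/
theorem rho_apply_eq_zero_of_killed {v : C} (h1 : (opsOf (ofRho ρ)).LE v = 0)
    (h2 : (opsOf (ofRho ρ)).LF v = 0) (h3 : (opsOf (ofRho ρ)).LH v = 0)
    (h4 : (opsOf (ofRho ρ)).RE v = 0) (h5 : (opsOf (ofRho ρ)).RF v = 0)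
    (h6 : (opsOf (ofRho ρ)).RH v = 0) {X : Matrix (Fin 2) (Fin 2) ℂ} (hX : X.trace = 0) :
    ρ X v = 0 := by
  simp only [opsOf_LE, opsOf_LF, opsOf_LH, opsOf_RE, opsOf_RF, opsOf_RH] at h1 h2 h3 h4 h5 h6
  have e := eq_of_trace_eq_zero hX
  set α := X 0 1
  set β := X 1 0
  set γ := X 0 0
  have e' : X.map (starRingEnd ℂ) = (starRingEnd ℂ α) • mE + (starRingEnd ℂ β) • mF +
      (starRingEnd ℂ γ) • mH := by
    rw [e, mE_eq, mF_eq, mH_eq]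
    ext i j; fin_cases i <;> fin_cases j <;> simp [Matrix.map_apply]
  rw [rho_eq_add ρ X, LinearMap.add_apply, e', e]
  simp only [map_add, map_smul, LinearMap.add_apply, LinearMap.smul_apply, h1, h2, h3, h4, h5, h6,
    smul_zero, add_zero]

end Rho

end GL2CKType

end Literature.NumberTheory.Automorphic

end
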